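import Mathlib.RingTheory.Localization.Ideal
import Mathlib.RingTheory.Localization.Basic
import Summits.Ventures.HSemireg.EmbeddedFirstOrderDeformationsTorsor
import HarnessLib

/-!
# Venture HSemireg — flat first-order thickenings and flat lifts LOCALISE (the restriction maps of the sheaf of
# lifts of Hartshorne, *Deformation Theory*, Thm. 6.2 (a), inside a NON-trivial thickening)

HONEST FRAMING.  Lean side of the computation cell `pub-hsemireg` (track «S4-PUSH» (ii), seat s4-prove-3 g3, second
route for (S5)); log `s4push/prove-3/ATTEMPT-6.md` §6 (ATTEMPT-7 part A).  Plain commutative algebra: a flat first-order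
thickening `π : R' ↠ R` with parameter `e` (`IsFirstOrderThickening`, this seat's `…Torsor` file), a submonoid
`T ⊆ R'`, and localisations `R'_T`, `R_{π(T)}`; no scheme, sheaf, Čech complex, abelian variety or semiregularity map
is constructed; nothing here says that HC, HC_CM or HC_AV holds; no object is certified; no Literature fact is declared.

WHY.  `…Torsor` proves Hartshorne Thm. 6.2 (a) affine: flat lifts of `I ⊆ R` to a flat first-order thickening
`R' ↠ R` form a pseudotorsor under `Hom_R(I, R/I)` (`IsLift.diff`, `translate`), with the cocycle identity that makes local
differences a Čech 1-cocycle; `…Cocycle` / `…BaseChange` treat the trivial thickening `R[ε]` and its base change.  For the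
GLUING half of PROPOSITION K's Čech sentence (G2-REDUCIBLE-POINT-THEOREM §3: compatible local flat lifts of `Z` inside the
non-trivial `A_ξ` glue) the thickening is NOT `R[ε]` globally, and one needs the RESTRICTION of the whole structure to the
opens `Spec R'_T` of `Spec R'`: THIS FILE proves that a flat first-order thickening LOCALISES to a flat first-order
thickening (`IsFirstOrderThickening.localization`) and that flat lifts RESTRICT to flat lifts (`IsLift.localization`),
with the value of the difference cocycle on restricted lifts computed by the restricted witnesses
(`IsLift.diff_localization_apply`).  Namespace `Summit.Ventures.HSemireg.EmbeddedDeformation`.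

CONTENT.  For `hT : IsFirstOrderThickening π e`, `T : Submonoid R'`, `[IsLocalization T R'ₜ]`,
`[IsLocalization (T.map π) Rₜ]`, `πₜ := IsLocalization.map Rₜ π _ : R'ₜ →+* Rₜ`, `eₜ := e/1`:
* §1 `IsFirstOrderThickening.localization`: `πₜ` is surjective, `ker πₜ = (eₜ)`, `eₜ² = 0`, `Ann(eₜ) ⊆ (eₜ)` — each by
  clearing one denominator from `T` and applying the corresponding field of `hT`;
* §2 `IsLift.localization`: `J·R'ₜ` is a flat lift of `I·Rₜ` to `πₜ` (`π(J) = I` localises; flatness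
  `e z ∈ J·R'ₜ ⇒ z - e w ∈ J·R'ₜ` by clearing denominators and `hJ.eps_flat`);
* §3 `IsLift.diff_localization_apply`: for `x ∈ I` with `z_i ∈ J_i` over `x` and `z₂ - z₁ = e w`,
  `(J₂·R'ₜ - J₁·R'ₜ)(x/1) = (π w)/1 mod I·Rₜ` — the difference of the restricted lifts is the restriction of the difference.

NOT covered: gluing (descent of ideals along a finite cover `(f_α) = R'`, locality of `IsLift`) — ATTEMPT-7 part B.

References: R. Hartshorne, *Deformation Theory*, GTM 257 (2010), §2 Thm. 2.4 («compatible with localization»), §6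
Thm. 6.2 (a) [corpus: book:springernd-deformation-theory p0015–p0016, p0047]; Mathlib `IsLocalization`.
-/

namespace Summit.Ventures.HSemireg

namespace EmbeddedDeformation

universe u v u' v'

variable {R' : Type u} {R : Type v} [CommRing R'] [CommRing R] {π : R' →+* R} {e : R'}
variable (T : Submonoid R') (R'ₜ : Type u') [CommRing R'ₜ] [Algebra R' R'ₜ] [IsLocalization T R'ₜ]
variable (Rₜ : Type v') [CommRing Rₜ] [Algebra R Rₜ]

/-- `T ≤ π⁻¹(π(T))`: the hypothesis under which `π` localises. [folklore] -/
theorem le_comap_map (π : R' →+* R) (T : Submonoid R') : T ≤ (T.map π).comap π :=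
  fun _ ht ↦ Submonoid.mem_comap.2 (Submonoid.mem_map_of_mem π ht)

variable (π) in
/-- **The localised thickening map** `πₜ : R'_T → R_{π(T)}`, `x/s ↦ π(x)/π(s)`. [folklore] -/
noncomputable abbrev locMap [IsLocalization (T.map π) Rₜ] : R'ₜ →+* Rₜ :=
  IsLocalization.map Rₜ π (le_comap_map π T)

variable [IsLocalization (T.map π) Rₜ]

/-- `πₜ (x/1) = π(x)/1`. [folklore] -/
theorem locMap_algebraMap (x : R') : locMap π T R'ₜ Rₜ (algebraMap R' R'ₜ x) = algebraMap R Rₜ (π x) :=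
  IsLocalization.map_eq _ x

/-- `πₜ (x/s) = π(x)/π(s)`. [folklore] -/
theorem locMap_mk' (x : R') (s : T) :
    locMap π T R'ₜ Rₜ (IsLocalization.mk' R'ₜ x s) =
      IsLocalization.mk' Rₜ (π x) ⟨π s, Submonoid.mem_map_of_mem π s.2⟩ :=
  IsLocalization.map_mk' _ x s

/-! ### §1 A flat first-order thickening localises to a flat first-order thickening -/

/-- Every element of `π(T)` is `π s` for some `s ∈ T` (with the witness packaged). [folklore] -/
theorem exists_eq_map_of_mem_map {t : R} (ht : t ∈ T.map π) : ∃ s : T, π s = t := by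
  obtain ⟨s, hs, rfl⟩ := Submonoid.mem_map.1 ht
  exact ⟨⟨s, hs⟩, rfl⟩

/-- Subtraction of fractions with a common denominator. [folklore] -/
theorem mk'_sub_mk' (a b : R') (y : T) :
    IsLocalization.mk' R'ₜ a y - IsLocalization.mk' R'ₜ b y = IsLocalization.mk' R'ₜ (a - b) y := by
  rw [IsLocalization.mk'_eq_mul_mk'_one a, IsLocalization.mk'_eq_mul_mk'_one b,
    IsLocalization.mk'_eq_mul_mk'_one (a - b), map_sub, sub_mul]

/-- **`πₜ` is surjective** (`π` is). [folklore] -/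
theorem locMap_surjective (hT : IsFirstOrderThickening π e) : Function.Surjective (locMap π T R'ₜ Rₜ) := by
  intro y
  obtain ⟨x, t, rfl⟩ := IsLocalization.exists_mk'_eq (T.map π) y
  obtain ⟨x', rfl⟩ := hT.surjective x
  obtain ⟨s, hs⟩ := exists_eq_map_of_mem_map T t.2
  refine ⟨IsLocalization.mk' R'ₜ x' s, ?_⟩
  rw [locMap_mk']
  congr 1
  exact Subtype.ext hs

/-- **`ker πₜ = (e/1)`.** [folklore] -/
theorem locMap_eq_zero_iff (hT : IsFirstOrderThickening π e) (z : R'ₜ) :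
    locMap π T R'ₜ Rₜ z = 0 ↔ ∃ w : R'ₜ, z = algebraMap R' R'ₜ e * w := by
  constructor
  · intro hz
    obtain ⟨x, s, rfl⟩ := IsLocalization.exists_mk'_eq T z
    rw [locMap_mk', IsLocalization.mk'_eq_zero_iff] at hz
    obtain ⟨m, hm⟩ := hz
    obtain ⟨t', ht'⟩ := exists_eq_map_of_mem_map T m.2
    have h0 : π ((t' : R') * x) = 0 := by rw [map_mul, ht']; exact hm
    obtain ⟨w, hw⟩ := (hT.ker_iff _).1 h0
    refine ⟨IsLocalization.mk' R'ₜ w (s * t'), ?_⟩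
    rw [IsLocalization.mul_mk'_eq_mk'_of_mul, ← hw, mul_comm (t' : R') x, IsLocalization.mk'_cancel]
  · rintro ⟨w, rfl⟩
    rw [map_mul, locMap_algebraMap, hT.map_eps, map_zero, zero_mul]

include T in
/-- **`Ann(e/1) ⊆ (e/1)`** in `R'_T`. [folklore] -/
theorem exists_eq_eps_mul_of_eps_mul_eq_zero (hT : IsFirstOrderThickening π e) (z : R'ₜ)
    (hz : algebraMap R' R'ₜ e * z = 0) : ∃ w : R'ₜ, z = algebraMap R' R'ₜ e * w := by
  obtain ⟨x, s, rfl⟩ := IsLocalization.exists_mk'_eq T z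
  rw [IsLocalization.mul_mk'_eq_mk'_of_mul, IsLocalization.mk'_eq_zero_iff] at hz
  obtain ⟨m, hm⟩ := hz
  have h0 : e * ((m : R') * x) = 0 := by rw [← hm]; ring
  obtain ⟨w, hw⟩ := hT.ann_le _ h0
  refine ⟨IsLocalization.mk' R'ₜ w (s * m), ?_⟩
  rw [IsLocalization.mul_mk'_eq_mk'_of_mul, ← hw, mul_comm (m : R') x, IsLocalization.mk'_cancel]

/-- **Localisation of a flat first-order thickening is a flat first-order thickening**: for
`hT : IsFirstOrderThickening π e` and a submonoid `T ⊆ R'`, the induced `πₜ : R'_T → R_{π(T)}` is a flat first-order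
thickening with parameter `e/1` (surjective; kernel `(e/1)`; `(e/1)² = 0`; `Ann(e/1) ⊆ (e/1)`) — the open
`Spec R'_T ⊂ Spec R'` of a first-order deformation of `Spec R` is a first-order deformation of `Spec R_{π(T)}`.
[cite: Hartshorne2010, §2 Thm. 2.4 («compatible with localization»)] -/
theorem IsFirstOrderThickening.localization (hT : IsFirstOrderThickening π e) :
    IsFirstOrderThickening (locMap π T R'ₜ Rₜ) (algebraMap R' R'ₜ e) where
  surjective := locMap_surjective T R'ₜ Rₜ hT
  ker_iff := locMap_eq_zero_iff T R'ₜ Rₜ hT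
  eps_sq := by rw [← map_mul, hT.eps_sq, map_zero]
  ann_le := exists_eq_eps_mul_of_eps_mul_eq_zero T R'ₜ hT

/-! ### §2 Flat lifts restrict to flat lifts -/

/-- `πₜ` maps `J·R'ₜ` into `I·Rₜ` when `π(J) ⊆ I`. [folklore] -/
theorem locMap_mem_map_of_mem_map {I : Ideal R} {J : Ideal R'} (hJ : ∀ z ∈ J, π z ∈ I) {z : R'ₜ}
    (hz : z ∈ J.map (algebraMap R' R'ₜ)) : locMap π T R'ₜ Rₜ z ∈ I.map (algebraMap R Rₜ) := by
  obtain ⟨x, s, rfl⟩ := IsLocalization.exists_mk'_eq T z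
  rw [IsLocalization.mk'_mem_map_algebraMap_iff T] at hz
  obtain ⟨t, ht, htx⟩ := hz
  rw [locMap_mk', IsLocalization.mk'_mem_map_algebraMap_iff (T.map π)]
  exact ⟨π t, Submonoid.mem_map_of_mem π ht, by rw [← map_mul]; exact hJ _ htx⟩

/-- **Restriction of a flat lift is a flat lift**: if `J` is a flat lift of `I` to `π : R' ↠ R`, then `J·R'_T` is a
flat lift of `I·R_{π(T)}` to `πₜ`.  (`π(J) = I` localises; flatness: if `(e/1)·(x/s) ∈ J·R'_T` then `t e x ∈ J` for
some `t ∈ T`, so `t x - e w ∈ J` by flatness of `J`, and `x/s - (e/1)(w/st) = (t x - e w)/(s t)`.)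
[cite: Hartshorne2010, §2 Thm. 2.4 («compatible with localization»)] -/
theorem IsLift.localization {I : Ideal R} {J : Ideal R'} (hJ : IsLift π e I J) :
    IsLift (locMap π T R'ₜ Rₜ) (algebraMap R' R'ₜ e) (I.map (algebraMap R Rₜ)) (J.map (algebraMap R' R'ₜ)) where
  map_mem _ hz := locMap_mem_map_of_mem_map T R'ₜ Rₜ hJ.map_mem hz
  exists_mem y hy := by
    obtain ⟨x, t, rfl⟩ := IsLocalization.exists_mk'_eq (T.map π) y
    rw [IsLocalization.mk'_mem_map_algebraMap_iff (T.map π)] at hy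
    obtain ⟨t₁, ht₁, ht₁x⟩ := hy
    obtain ⟨s₁, rfl⟩ := exists_eq_map_of_mem_map T ht₁
    obtain ⟨s, hs⟩ := exists_eq_map_of_mem_map T t.2
    obtain ⟨j, hj, hjx⟩ := hJ.exists_mem _ ht₁x
    refine ⟨IsLocalization.mk' R'ₜ j (s₁ * s), ?_, ?_⟩
    · rw [IsLocalization.mk'_mem_map_algebraMap_iff T]
      exact ⟨1, T.one_mem, by rw [one_mul]; exact hj⟩
    · rw [locMap_mk', IsLocalization.mk'_eq_iff_eq]
      refine congrArg _ ?_
      simp only [Submonoid.coe_mul, map_mul, hjx, ← hs]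
      ring
  eps_flat z hz := by
    obtain ⟨x, s, rfl⟩ := IsLocalization.exists_mk'_eq T z
    rw [IsLocalization.mul_mk'_eq_mk'_of_mul, IsLocalization.mk'_mem_map_algebraMap_iff T] at hz
    obtain ⟨t, ht, htx⟩ := hz
    have h1 : e * (t * x) ∈ J := by rw [show e * (t * x) = t * (e * x) by ring]; exact htx
    obtain ⟨w, hw⟩ := hJ.eps_flat _ h1
    refine ⟨IsLocalization.mk' R'ₜ w (s * ⟨t, ht⟩), ?_⟩
    have e1 : IsLocalization.mk' R'ₜ x s = IsLocalization.mk' R'ₜ (x * t) (s * ⟨t, ht⟩) :=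
      (IsLocalization.mk'_cancel x s ⟨t, ht⟩).symm
    rw [e1, IsLocalization.mul_mk'_eq_mk'_of_mul, mk'_sub_mk', IsLocalization.mk'_mem_map_algebraMap_iff T]
    exact ⟨1, T.one_mem, by rw [one_mul, show x * t - e * w = t * x - e * w by ring]; exact hw⟩

/-! ### §3 The difference cocycle restricts -/

/-- **The difference of the restricted lifts is the restriction of the difference**: for `x ∈ I`, `z_i ∈ J_i` over
`x` with `z₂ - z₁ = e w`, the difference `J₂·R'_T - J₁·R'_T ∈ Hom(I·R_{π(T)}, R_{π(T)}/I·R_{π(T)})` takes the value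
`(π w)/1 mod I·R_{π(T)}` at `x/1` — i.e. it is compatible, along `R → R_{π(T)}`, with `J₂ - J₁`
(whose value at `x` is `π w mod I`, `IsLift.diff_apply_eq`).  [cite: Hartshorne2010, §6 Thm. 6.2 (a)] -/
theorem IsLift.diff_localization_apply (hT : IsFirstOrderThickening π e) {I : Ideal R} {J₁ J₂ : Ideal R'}
    (h₁ : IsLift π e I J₁) (h₂ : IsLift π e I J₂) {x : R} (hx : x ∈ I) {z₁ z₂ w : R'} (hz₁ : z₁ ∈ J₁)
    (hz₂ : z₂ ∈ J₂) (e₁ : π z₁ = x) (e₂ : π z₂ = x) (hw : z₂ - z₁ = e * w) :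
    (h₁.localization T R'ₜ Rₜ).diff (hT.localization T R'ₜ Rₜ) (h₂.localization T R'ₜ Rₜ)
        ⟨algebraMap R Rₜ x, Ideal.mem_map_of_mem _ hx⟩ =
      Ideal.Quotient.mk (I.map (algebraMap R Rₜ)) (algebraMap R Rₜ (π w)) := by
  rw [← locMap_algebraMap T R'ₜ Rₜ w]
  exact (h₁.localization T R'ₜ Rₜ).diff_apply_eq (hT.localization T R'ₜ Rₜ) (h₂.localization T R'ₜ Rₜ)
    (Ideal.mem_map_of_mem _ hz₁) (Ideal.mem_map_of_mem _ hz₂)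
    (by rw [locMap_algebraMap, e₁]) (by rw [locMap_algebraMap, e₂])
    (by rw [← map_sub, hw, map_mul])

end EmbeddedDeformation

end Summit.Ventures.HSemireg
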